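import Summits.BirchSwinnertonDyer.BirchSwinnertonDyer.Theorems.ThetaPartnerAtTwoSignedMainConjectureCMTwoRankZeroLowerOffTwoAtTwo
import Summits.BirchSwinnertonDyer.BirchSwinnertonDyer.Theorems.ThetaPartnerAtTwoSignedMainConjectureCMTwoRankZeroLowerOffTwoPackage
import Literature.NumberTheory.EllipticCurves.Kobayashi2003.SignedSelmerDualToFineDualProofs
import Literature.NumberTheory.EllipticCurves.Kobayashi2003.SignedSelmerDualExistsProofs
import Literature.NumberTheory.EllipticCurves.KatoFineSelmerDualProofs
import Summits.BirchSwinnertonDyer.BirchSwinnertonDyer.Theorems.ThetaPartnerAtTwoSignedKatoUpToAtTwoOffTwoFinite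
import Literature.NumberTheory.EllipticCurves.IwasawaAlgebraDivisibilityProofs
import HarnessLib

/-!
# Route `ThetaPartnerAtTwo` (TP2), crux K2r0P `SignedMainConjectureCMTwoRankZeroOfPub` (stmt-BirchSwinnertonDyer-24945),
# line `rankzero` v14: `X₀(A/ℚ_∞)` is `Λ`-torsion from print at analytic rank `0`, and the LOWER Coleman–Poitou–Tate package
# with its definitional clause (`X⁺ ↠ X₀`) DISCHARGED (route-independent)

HONEST FRAMING (cell `pub/bsd-wall`, W-ALL row 1; width seat `bsd-wall-tp2-p2-w2` g2, `--supports` only; the lead `bsd-wall-tp2-p2` holds the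
item). THEOREMS ONLY — no definition, no named fact, no instance, no `sorry`, no `Theses` import; this file closes no item; the crux is NOT
proved; BSD is NOT proved by any of this.

* §1 `fineSelmerDual_finiteTorsion_twoRankZero_of_pub` — for EVERY `A/ℚ` (globally minimal, CM or not) of analytic rank `0`, good supersingular
  at `2`, `a₂ = 0`, every cyclotomic top-generator pair `(κ, γ)` and every dual datum `Y` of the FINE Selmer group `Sel₀(ℚ_∞, A[2^∞])`:
  `X₀ = Y.X` is finitely generated and `Λ`-TORSION — from print (GZK + Greenberg's five facts): `X⁺` is torsion
  (`SignedLowerOffTwo.signedTorsionTwoRankZero_of_pub`, part 2) and `X₀` is a `Λ`-quotient of `X⁺`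
  (`Kobayashi2003.SignedSelmerDualData.exists_linearMap_toFineDual`: the transpose of `Sel₀ ≤ Sel⁺`); also `ℓ_𝔭(X₀) ≤ ℓ_𝔭(X⁺)` everywhere
  (`fineSelmerDual_lengthAt_le_signed_twoRankZero`). Kato's Thm. 12.4-type torsion of `X₀` for the CM partner at `2` thus needs no Euler system.
* §2 `offTwoLower_of_lowerColemanPackageTwo_toFineDual` — the LOWER package of `SignedLowerOffTwo.offTwoLower_of_lowerColemanPackageTwo`
  (p610603) with its clause (d) «`k : X⁺ → X₀` onto» DISCHARGED and clause (c) read on THE transpose `k` of `Sel₀ ≤ Sel⁺`: the provider is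
  handed `Y`, a `Λ`-linear surjective `k : D.X → Y.X` with `Y.toDual (k x) s = D.toDual x s`, and must produce only `I`, `P`, `col`, `j`, `s`
  with (b) `ker j ≤ range col` (deep Poitou–Tate half), (c) `k ∘ j = 0`, (a′) `col s ≠ 0` in `Λ` (injectivity of `col` then follows from
  Gross–Zagier–Kolyvagin at analytic rank `0`: `rank_Λ 𝐇¹ ≤ 1`, `𝐇¹` torsion free — the K3 lead's `SignedKatoOffTwo.injective_col_of_gzk`,
  re-proved here route-independently), (e) `ℓ_𝔭(Λ/P) = 0` (`Col⁺` onto off `2`), (f) `ℓ_𝔭(Λ/(L♭)) ≤ ℓ_𝔭(Λ/(col s))`, (g) `ℓ_𝔭(𝐇¹/Λs) ≤ ℓ_𝔭(X₀)`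
  (the EQUALITY half of Kato's IMC for `f_A` off `(2)` — RESEARCH at `p = 2`). Then (LDℓ)_A holds, hence (part 2) the registered stub and,
  with (μ♭)_A and PUB, the crux body.

References: [Kobayashi2003] Def. 1.1, Thm. 1.2, (7.17)–(7.21), Thm. 7.3 (pp. 2, 12–13); [Kato2004Asterisque] Thm. 12.4, Conj. 12.10, §15, §17.13;
[GreenbergLNM1716] §1 p. 60, §4; [BDKim2013] Cor. 3.15; [CoatesSujatha2005] §3.
-/

set_option autoImplicit false
-- the Theorems namespace of this sub repeats the summit name by design (D-0017 nested layout)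
set_option linter.dupNamespace false

noncomputable section

open scoped Classical NumberField MatrixGroups ModularForm

open NumberField IsDedekindDomain CongruenceSubgroup

namespace Summit.BirchSwinnertonDyer.BirchSwinnertonDyer.Theorems

open Literature.NumberTheory.EllipticCurves Literature.NumberTheory.GaloisRepresentations
  WeierstrassCurve ZpExtension Literature.NumberTheory.EllipticCurves.Kobayashi2003
  Literature.NumberTheory.EllipticCurves.Module Literature.NumberTheory.EllipticCurves.Kato2004
  Literature.NumberTheory.EllipticCurves.IwasawaDual Literature.NumberTheory.EllipticCurves.GreenbergVatsal2000
  Literature.NumberTheory.EllipticCurves.ModularForms Literature.NumberTheory.EllipticCurves.Rank1Residual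
  Literature.NumberTheory.EllipticCurves.Rank1Residual.Typed
  Summit.BirchSwinnertonDyer.Rank1Residual Summit.BirchSwinnertonDyer.Rank1Residual.Supersingular

namespace SignedLowerOffTwo

/-! ## §1 `X₀(A/ℚ_∞)` finitely generated and `Λ`-torsion at analytic rank `0`, from print -/

section FineTorsion

/-- **`X₀(A/ℚ_∞)` is finitely generated and `Λ`-torsion at analytic rank `0` — from print, for every curve of the supersingular `a₂ = 0`
class at `2` (no CM hypothesis).** Granted BY NAME GZK (`hGZK`) and Greenberg's five structure facts: for every `A/ℚ` (globally minimal) with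
`r_an = 0`, `GoodSS A 2`, `a₂ = 0`, every cyclotomic top-generator pair `(κ, γ)` and every dual datum `Y` of `Sel₀(ℚ_∞, A[2^∞])`, the Iwasawa
module `Y.X = X₀(A/ℚ_∞)` is finitely generated and torsion: `X⁺` is (part 2, `signedTorsionTwoRankZero_of_pub`, via the signed Euler
characteristic at `2` and the landed HONDA⁺@2), and `X₀` is a `Λ`-linear quotient of `X⁺` (the transpose of `Sel₀ ≤ Sel⁺`,
`SignedSelmerDualData.exists_linearMap_toFineDual`; a signed dual datum exists: `nonempty_signedSelmerDualData`).
[cite: Kobayashi2003, Thm. 1.2 (p. 2) and (7.21) (p. 12)] [cite: GreenbergLNM1716, §1 p. 60, §4 Props. 4.12–4.13] [cite: BDKim2013, Cor. 3.15 (p. 199)] -/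
theorem fineSelmerDual_finiteTorsion_twoRankZero_of_pub
    (hGZK : rank_eq_analyticRank_of_analyticRank_le_one)
    (hC : Greenberg1999.casselsSurjectivity_H1Sigma ℚ)
    (h412 : Greenberg1999.prop412_noFiniteSubmodule_H1Sigma_of_rank_one)
    (hcork : Greenberg1999.h1Sigma_zpCorank_le_degree ℚ)
    (hP108 : Greenberg1999.localQuotient_restriction_surjective ℚ)
    (hWL : Greenberg1999.h1SigmaInfty_rank_eq_one) :
    ∀ (A : WeierstrassCurve ℚ) [A.IsElliptic] [A.IsGloballyMinimal],
      A.analyticRank = 0 → GoodSS A 2 → A.frobeniusTrace 2 = 0 →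
      ∀ (κ : ZpExtension ℚ 2) (γ : Field.absoluteGaloisGroup ℚ), κ.IsCyclotomic → κ.IsTopGenerator γ →
      ∀ Y : A.FineSelmerDualData κ γ,
        Module.Finite (IwasawaAlgebra 2) Y.X ∧ Module.IsTorsion (IwasawaAlgebra 2) Y.X := by
  intro A _ _ hr hss ha κ γ hκ hγ Y
  obtain ⟨D⟩ := nonempty_signedSelmerDualData (W := A) (κ := κ) (ε := 1) hγ
  have hX := signedTorsionTwoRankZero_of_pub hGZK hC h412 hcork hP108 hWL A hr hss ha κ γ hκ hγ D
  exact ⟨D.fineDual_moduleFinite hγ Y, D.fineDual_isTorsion hγ Y hX⟩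

/-- **`ℓ_𝔭(X₀(A/ℚ_∞)) ≤ ℓ_𝔭(X⁺(A/ℚ_∞))` at every prime of `Λ`**, for every dual datum `D` of `Sel⁺(A/ℚ_∞)` and `Y` of `Sel₀` over the same
top-generator pair (any `A`, any `K = ℚ`-cyclotomic datum): the transpose of `Sel₀ ≤ Sel⁺` is onto. [cite: Kobayashi2003, (7.21) (p. 12)] -/
theorem fineSelmerDual_lengthAt_le_signed {A : WeierstrassCurve ℚ} [A.IsElliptic] {κ : ZpExtension ℚ 2}
    {γ : Field.absoluteGaloisGroup ℚ} (hγ : κ.IsTopGenerator γ) (D : SignedSelmerDualData A κ γ 1)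
    (Y : A.FineSelmerDualData κ γ) (𝔭 : PrimeSpectrum (IwasawaAlgebra 2)) :
    lengthAt (IwasawaAlgebra 2) Y.X 𝔭 ≤ lengthAt (IwasawaAlgebra 2) D.X 𝔭 :=
  D.fineDual_lengthAt_le hγ Y 𝔭

end FineTorsion

/-! ## §2 The LOWER package with the transpose `X⁺ ↠ X₀` handed to the provider -/

section AtTwo

/-- **Injectivity of a Coleman-type map at analytic rank `0` from Gross–Zagier–Kolyvagin** (the K3 lead's
`SignedKatoOffTwo.injective_col_of_gzk`, re-proved here to stay route-independent): every `Λ`-linear `col : 𝐇¹_Γ(T_pW) → P ≤ Λ` with ONE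
value `col s ≠ 0` in `Λ` is injective — `rank_Λ 𝐇¹ ≤ 1` ((R0) at rank `0`) and `𝐇¹` torsion free, `Λ` a domain.
[cite: Kato2004Asterisque, §17.13 (17.13.2) (p. 279), Thm. 12.4 (2) (p. 221)] [cite: Darmon2004, Thm. 3.22] -/
private theorem injective_col_of_gzk (h17 : rank_eq_analyticRank_of_analyticRank_le_one)
    {W : WeierstrassCurve ℚ} [W.IsElliptic] (hr : W.analyticRank = 0) {p : ℕ} [Fact p.Prime]
    [ContinuousSMul ℤ_[p] (W.tateModule p)] {κ : ZpExtension ℚ p} {γ : Field.absoluteGaloisGroup ℚ}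
    (hκ : κ.IsCyclotomic) (hγ : κ.IsTopGenerator γ) (I : Kato2004.IwasawaH1Data W p κ γ)
    {P : Submodule (IwasawaAlgebra p) (IwasawaAlgebra p)} (col : I.H →ₗ[IwasawaAlgebra p] P) {s : I.H}
    (hcs : (P.subtype (col s) : IwasawaAlgebra p) ≠ 0) : Function.Injective col := by
  obtain ⟨hrank, hsha⟩ := h17 W (by rw [hr]; exact zero_le_one)
  have h0 : W.mordellWeilRank = 0 := by rw [hrank, hr]
  haveI : Finite W.toAffine.Point := W.finite_point_of_rank_zero h0
  haveI : Finite W.sha := hsha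
  haveI : Finite (AddCommGroup.primaryComponent W.sha p) := inferInstance
  have hrank1 : Module.rank (IwasawaAlgebra p) I.H ≤ 1 :=
    I.rank_le_one_of_rank_integralH1_le_one hκ hγ (IntegralH1RankZero.rank_integralH1_layerZero_le_one W p κ)
  haveI : Module.IsTorsionFree (IwasawaAlgebra p) I.H := I.isTorsionFree hγ
  refine injective_of_rank_le_one hrank1 col s fun a ha ↦ ?_
  have ha' : a * (P.subtype (col s) : IwasawaAlgebra p) = 0 := by
    rw [← smul_eq_mul, ← map_smul, ha, map_zero]
  exact (mul_eq_zero.mp ha').resolve_right hcs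

/-- **(LDℓ)_A from a LOWER `2`-adic Coleman–Poitou–Tate package, clause (d) discharged.** If for every CM `A/ℚ` of the crux class off the unit
zone, every cyclotomic datum matching the variable, newform, period ratio, Pollack pair at `2`, dual datum `D` of `Sel⁺(A/ℚ_∞)` with `X⁺`
torsion, EVERY fine dual datum `Y` with a `Λ`-linear SURJECTIVE `k : X⁺ → X₀` transposing `Sel₀ ≤ Sel⁺` (`Y.toDual (k x) s = D.toDual x s`),
and every height-one `𝔭 ∌ 2`, there are `I : IwasawaH1Data A 2 κ γ`, `P ≤ Λ`, `col : 𝐇¹ → P`, `j : P → X⁺` with `ker j ≤ range col` and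
`k ∘ j = 0`, `ℓ_𝔭(Λ/P) = 0`, and `s ∈ 𝐇¹` with `col s ≠ 0`, `ℓ_𝔭(Λ/(L♭)) ≤ ℓ_𝔭(Λ/(col s))` and `ℓ_𝔭(𝐇¹/Λs) ≤ ℓ_𝔭(X₀)`, THEN — granted
Gross–Zagier–Kolyvagin (`hGZK`, PUB; it makes `col` injective: `rank_Λ 𝐇¹ ≤ 1`, torsion free) — (LDℓ)_A holds. The transpose `k` exists and is
onto by `SignedSelmerDualData.exists_linearMap_toFineDual` and a fine dual datum exists (`nonempty_fineSelmerDualData`), so the package provider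
proves only (a′), (b), (c), (e), (f), (g); then `lengthAt_quotient_le_of_fourTerm_ge`.
[cite: Kobayashi2003, Thm. 6.2–6.3 (p. 11), (7.21), proof of Thm. 7.4 (p. 13)] [cite: Kato2004Asterisque, Conj. 12.10 (p. 224), Lemma 15.13 (p. 264), §17.13 (p. 280)] -/
theorem offTwoLower_of_lowerColemanPackageTwo_toFineDual (hGZK : rank_eq_analyticRank_of_analyticRank_le_one)
    (hPkg : ∀ (A : WeierstrassCurve ℚ) [A.IsElliptic] [A.IsGloballyMinimal],
      A.HasCM → A.analyticRank = 0 → GoodSS A 2 → A.frobeniusTrace 2 = 0 →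
      2 ∣ A.shaOrder * A.tamagawaProduct →
      ∀ (κ : ZpExtension ℚ 2) (γ : Field.absoluteGaloisGroup ℚ),
        κ.IsCyclotomic → κ.IsTopGenerator γ → IsCyclotomicVariable 2 γ →
      ∀ [NeZero (A.conductorNorm ℤ)] (f : CuspForm (Gamma0 (A.conductorNorm ℤ)) 2),
        IsNewformOf A f → ∀ (ϖ : ℚ), (ϖ : ℝ) * A.realPeriodRat = plusPeriod f →
      ∀ (Lplus Lminus : IwasawaAlgebra 2), IsPollackPair f 2 Lplus Lminus →
      ∀ (D : SignedSelmerDualData A κ γ 1) [ContinuousSMul ℤ_[2] (A.tateModule 2)],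
        Module.IsTorsion (IwasawaAlgebra 2) D.X →
      ∀ (Y : A.FineSelmerDualData κ γ) (k : D.X →ₗ[IwasawaAlgebra 2] Y.X), Function.Surjective k →
        (∀ (x : D.X) (s : A.fineSelmerInfty κ),
          Y.toDual (k x) s = D.toDual x (AddSubgroup.inclusion (fineSelmerInfty_le_signedSelmerInfty A κ 1) s)) →
        ∀ 𝔭 : PrimeSpectrum (IwasawaAlgebra 2), 𝔭.asIdeal.height = 1 →
          PowerSeries.C (2 : ℤ_[2]) ∉ 𝔭.asIdeal →
        ∃ (I : Kato2004.IwasawaH1Data A 2 κ γ) (P : Submodule (IwasawaAlgebra 2) (IwasawaAlgebra 2))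
          (col : I.H →ₗ[IwasawaAlgebra 2] P) (j : P →ₗ[IwasawaAlgebra 2] D.X) (s : I.H),
          LinearMap.ker j ≤ LinearMap.range col ∧ (∀ x, k (j x) = 0) ∧
          (P.subtype (col s) : IwasawaAlgebra 2) ≠ 0 ∧
          lengthAt (IwasawaAlgebra 2) (IwasawaAlgebra 2 ⧸ P) 𝔭 = 0 ∧
          lengthAt (IwasawaAlgebra 2) (IwasawaAlgebra 2 ⧸ Ideal.span {kobayashiL 1 Lplus Lminus}) 𝔭 ≤
            lengthAt (IwasawaAlgebra 2) (IwasawaAlgebra 2 ⧸ Ideal.span {(P.subtype (col s))}) 𝔭 ∧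
          lengthAt (IwasawaAlgebra 2) (I.H ⧸ Submodule.span (IwasawaAlgebra 2) {s}) 𝔭 ≤
            lengthAt (IwasawaAlgebra 2) Y.X 𝔭) :
    ∀ (A : WeierstrassCurve ℚ) [A.IsElliptic] [A.IsGloballyMinimal],
      A.HasCM → A.analyticRank = 0 → GoodSS A 2 → A.frobeniusTrace 2 = 0 →
      2 ∣ A.shaOrder * A.tamagawaProduct →
      ∀ (κ : ZpExtension ℚ 2) (γ : Field.absoluteGaloisGroup ℚ),
        κ.IsCyclotomic → κ.IsTopGenerator γ → IsCyclotomicVariable 2 γ →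
      ∀ [NeZero (A.conductorNorm ℤ)] (f : CuspForm (Gamma0 (A.conductorNorm ℤ)) 2),
        IsNewformOf A f → ∀ (ϖ : ℚ), (ϖ : ℝ) * A.realPeriodRat = plusPeriod f →
      ∀ (Lplus Lminus : IwasawaAlgebra 2), IsPollackPair f 2 Lplus Lminus →
      ∀ (D : SignedSelmerDualData A κ γ 1), Module.IsTorsion (IwasawaAlgebra 2) D.X →
        ∀ 𝔭 : PrimeSpectrum (IwasawaAlgebra 2), 𝔭.asIdeal.height = 1 →
          PowerSeries.C (2 : ℤ_[2]) ∉ 𝔭.asIdeal →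
          lengthAt (IwasawaAlgebra 2) (IwasawaAlgebra 2 ⧸ Ideal.span {kobayashiL 1 Lplus Lminus}) 𝔭 ≤
            lengthAt (IwasawaAlgebra 2) D.X 𝔭 := by
  intro A _ _ hcm hr hss ha hz κ γ hκ hγ hcv _ f hf ϖ hϖ Lplus Lminus hPP D hX 𝔭 h𝔭 hp𝔭
  haveI : ContinuousSMul ℤ_[2] (A.tateModule 2) := TateModule.continuousSMul_padicInt
  haveI : Module.Finite (IwasawaAlgebra 2) D.X := D.moduleFinite hγ
  obtain ⟨Y⟩ := A.nonempty_fineSelmerDualData κ hγ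
  obtain ⟨k, hk, hkY⟩ := D.exists_linearMap_toFineDual hγ Y
  obtain ⟨I, P, col, j, s, hjc, hkj, hcs, hcoker, hdiv, hIMC⟩ :=
    hPkg A hcm hr hss ha hz κ γ hκ hγ hcv f hf ϖ hϖ Lplus Lminus hPP D hX Y k hk hkY 𝔭 h𝔭 hp𝔭
  have hcol : Function.Injective col := injective_col_of_gzk hGZK hr hκ hγ I col hcs
  -- `ℓ_𝔭(X₀) ≤ ℓ_𝔭(X⁺) < ⊤`
  have hXfin : lengthAt (IwasawaAlgebra 2) D.X 𝔭 ≠ ⊤ := by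
    obtain ⟨-, -, -, hfin, -, -⟩ := SkinnerUrban2014.exists_charIdeal_eq_span_prod (M := D.X) hX
    exact hfin 𝔭 h𝔭
  have hYfin : lengthAt (IwasawaAlgebra 2) Y.X 𝔭 ≠ ⊤ :=
    ne_top_of_le_ne_top hXfin (lengthAt_le_of_surjective k hk 𝔭)
  have hrange : LinearMap.range P.subtype = P := P.range_subtype
  have hcoker' : lengthAt (IwasawaAlgebra 2) (IwasawaAlgebra 2 ⧸ LinearMap.range P.subtype) 𝔭 = 0 := by
    rw [lengthAt_eq_of_linearEquiv (Submodule.quotEquivOfEq _ _ hrange) 𝔭]; exact hcoker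
  exact lengthAt_quotient_le_of_fourTerm_ge P.subtype P.injective_subtype col hcol j k hjc hkj hk s 𝔭
    hcoker' hdiv hIMC hYfin

end AtTwo

end SignedLowerOffTwo

end Summit.BirchSwinnertonDyer.BirchSwinnertonDyer.Theorems

end
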